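import Mathlib.AlgebraicGeometry.EllipticCurve.LFunction
import Mathlib.NumberTheory.LSeries.Convergence
import Mathlib.Analysis.SpecialFunctions.Gamma.Basic
import Mathlib.Algebra.Squarefree.Basic
import Mathlib.Data.Set.Card
import Literature.NumberTheory.EllipticCurves.MordellWeil
import Literature.NumberTheory.EllipticCurves.HeightFamily
import HarnessLib

-- provenance: harness21/H21/H21/Statements/BSD/Wave0.lean @ 681371f (interim HEAD d8f2665); M5 mechanical rewrite
/-!
# BSD family — wave 0 statements

Family: `bsd` (Birch and Swinnerton-Dyer conjecture and its known partial results),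
gap inventory 2026-08-12. This file states, in Mathlib style, the seven inventory statements
marked `statable_today`:

* **bsd.S04** Mordell–Weil theorem (Mordell 1922, Weil 1929; Silverman AEC VIII.6.7);
* **bsd.S05** Mazur's torsion theorem (Mazur, Publ. Math. IHÉS 47 (1977) Thm 8);
* **bsd.S06** the L-series `L(E,s) = ∑ aₙ n⁻ˢ` of an elliptic curve over a number field and its
  absolute convergence for `Re s > 3/2` (Silverman AEC App. C §16);
* **bsd.S07** the Hasse bound `|q + 1 - #E(𝔽_q)| ≤ 2√q` (Hasse 1933; Silverman AEC V.1.1);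
* **bsd.S08** modularity ⇒ analytic continuation of `L(E,s)` to an entire function
  (Wiles 1995; Taylor–Wiles 1995; Breuil–Conrad–Diamond–Taylor 2001). Only the continuation
  clause is inventory-statable; we additionally state the functional equation in
  *continuation form*: there is an entire `Λ` agreeing with `N^{s/2}(2π)^{-s}Γ(s)L(E,s)` on
  `Re s > 3/2` and satisfying `Λ(s) = w Λ(2-s)`, with the level `N` and sign `w = ±1`
  existentially quantified (the named conductor `N_E` and root number `w(E)` are inventory
  notions `conductor`, `root_number`; the sharp form lives in `Literature.Statements.BSD.RootNumber`);
* **bsd.S26** Bhargava–Shankar, average-rank clause: ordered by naive height, the average rank of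
  elliptic curves over `ℚ` is bounded (`≤ 3/2`, resp. `≤ 0.885`) and a positive proportion have
  rank `0` (Bhargava–Shankar, Ann. of Math. 181 (2015)). The `2`-Selmer clause is skipped here
  (notion `selmer_group_elliptic`; see `Literature.Statements.BSD.Selmer`);
* **bsd.S29** Tunnell's theorem, unconditional direction (Tunnell, Invent. Math. 72 (1983);
  Koblitz, *Introduction to Elliptic Curves and Modular Forms*, Ch. IV). The converse direction,
  conditional on BSD(RANK) for `E_n : y² = x³ - n²x`, is skipped here (notion `analytic_rank`;
  see `Literature.Statements.BSD.AnalyticRank`).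

Skipped ids: all other `bsd.Sxx` (not `statable_today` in the inventory; they need the notions
`analytic_rank`, `sha_group`, `selmer_group_elliptic`, `conductor`, `root_number`, … of trunk
T-ELLARITH / T-GALREP and are treated in the later BSD statement files).

## References

* [SilvermanAEC2009] Silverman, *The Arithmetic of Elliptic Curves*, 2nd ed. (2009): Thm. V.1.1
  (Hasse), Thm. VIII.6.7 (Mordell–Weil), App. C §16.
* [Mazur1977] Mazur, *Modular curves and the Eisenstein ideal*, Publ. Math. IHÉS 47 (1977), Thm 8.
* [BCDTJAMS2001] Breuil–Conrad–Diamond–Taylor, JAMS 14 (2001) 843–939, Thm. A.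
* [BhargavaShankarAnnals2015], [BhargavaShankarTernary2015], [BhargavaShankar5Selmer2013]
  (arXiv:1312.7859).
* [Tunnell1983Congruent] Tunnell, Invent. Math. 72 (1983) 323–334, Theorem.

## Design choices

* An elliptic curve over a field `K` is a `W : WeierstrassCurve K` with `[W.IsElliptic]`; its
  Mordell–Weil group `E(K)` is `W.toAffine.Point` with Mathlib's `AddCommGroup` instance
  (the point at infinity is `0`), elaborated against `open scoped Classical` (no `[DecidableEq]`
  variables), as in the T-ELLARITH preludes.
* The Mordell–Weil rank is the prelude's `WeierstrassCurve.mordellWeilRank`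
  (`Literature.Prelude.TranscendEllArithS.MordellWeil`); the height-ordered family
  (`Literature.NumberTheory.EllipticCurves.shortWeierstrass`, `Literature.NumberTheory.EllipticCurves.IsInHeightFamily`, `Literature.NumberTheory.EllipticCurves.naiveHeight`, `Literature.NumberTheory.EllipticCurves.heightFamilyBelow`,
  `Literature.NumberTheory.EllipticCurves.heightAverage`, `Literature.NumberTheory.EllipticCurves.HeightAverageLE`, `Literature.NumberTheory.EllipticCurves.HeightDensityGE`) is the prelude's
  (`Literature.Prelude.TranscendEllArithS.HeightFamily`). The former Wave0 copies of these definitions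
  are removed; only the abbreviation `Literature.BSD.mordellWeilRank := WeierstrassCurve.mordellWeilRank`
  is kept, because `Literature.Statements.BSD.AnalyticRank` refers to that name (its `rfl` bridge
  `mordellWeilRank_eq_wave0` stays valid); the supervisor may delete both together.
* **bsd.S04** is stated in alias form: `addGroup_fg_point` / `module_finite_int_point` take the
  prelude's named fact `WeierstrassCurve.module_finite_point` (`MordellWeil.lean`) as hypothesis
  `h`, so the tagged statements carry no `sorry` and duplicate no fact.
* `L(E,s)` is Mathlib's `WeierstrassCurve.LSeries`, built from
  `WeierstrassCurve.LFunction : ArithmeticFunction ℤ` with the correct bad Euler factors; its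
  coefficient sequence is `(↑) ∘ W.LFunction : ℕ → ℂ` (no auxiliary definition).
* Functional equation and `Complex.Gamma` (review item 1): Mathlib's `Complex.Gamma` takes the
  junk value `0` on `ℤ_{≤0}` (`Complex.Gamma_neg_nat_eq_zero`), so the raw product
  `N^{s/2}(2π)^{-s}Γ(s)g(s)` cannot satisfy `Λ(s) = w Λ(2-s)` for all `s`. The functional
  equation is therefore asserted only for an *entire continuation* `Λ` of the raw product from
  the half-plane `Re s > 3/2` (where `Γ` has no junk values); such `Λ` is unique by the identity
  theorem.
* Densities / averages over the height-ordered family are phrased with `∀ ε > 0, ∀ᶠ X in atTop`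
  (`Literature.NumberTheory.EllipticCurves.HeightAverageLE`, `Literature.NumberTheory.EllipticCurves.HeightDensityGE`) rather than `Filter.limsup`/`liminf`, to avoid
  the junk value of `limsup` on unbounded real sequences.
* Point counts of positive-definite ternary quadratic forms are `Set.ncard` of (finite) subsets
  of `ℤ × ℤ × ℤ`.
-/

noncomputable section

namespace Literature.NumberTheory.EllipticCurves

open scoped Classical
open Filter WeierstrassCurve

/-! ### bsd.S04 — Mordell–Weil -/

section MordellWeil

variable {K : Type*} [Field K] [NumberField K] (W : WeierstrassCurve K) [W.IsElliptic]

/-- **bsd.S04** (Mordell–Weil theorem; Mordell 1922, Weil 1929; Silverman, *The Arithmetic of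
Elliptic Curves*, Thm VIII.6.7). For an elliptic curve `E` over a number field `K`, the group of
rational points `E(K)` is a finitely generated abelian group. Alias form (D-0014): derived from
the prelude's named fact `WeierstrassCurve.module_finite_point` (hypothesis `h`) through
`WeierstrassCurve.addGroup_fg_point`. [cite: SilvermanAEC2009, Thm. VIII.6.7] -/
theorem addGroup_fg_point (h : W.module_finite_point) : AddGroup.FG W.toAffine.Point :=
  WeierstrassCurve.addGroup_fg_point (W := W) h

/-- **bsd.S04** (Mordell–Weil theorem, module form; Silverman AEC VIII.6.7). `E(K)` is a finite
`ℤ`-module; equivalent to `Literature.NumberTheory.EllipticCurves.addGroup_fg_point`. Alias form of the prelude's named fact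
`WeierstrassCurve.module_finite_point` (hypothesis `h`). [folklore] -/
theorem module_finite_int_point (h : W.module_finite_point) : Module.Finite ℤ W.toAffine.Point :=
  h

/-- Compatibility abbreviation for the Mordell–Weil rank `rank_ℤ E(K) = finrank ℤ E(K)`: this is
the prelude's `WeierstrassCurve.mordellWeilRank` (Silverman AEC VIII.6; junk value `0` if `E(K)`
is not finitely generated, which does not happen over number fields). Kept under this name only
because `Literature.Statements.BSD.AnalyticRank` refers to `Literature.NumberTheory.EllipticCurves.mordellWeilRank`. [folklore] -/
abbrev mordellWeilRank {F : Type*} [Field F] (W : WeierstrassCurve F) : ℕ :=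
  W.mordellWeilRank

end MordellWeil

/-! ### bsd.S05 — Mazur's torsion theorem -/

section Mazur

variable (W : WeierstrassCurve ℚ)

/-- **bsd.S05** (Mazur's torsion theorem; Mazur, *Modular curves and the Eisenstein ideal*,
Publ. Math. IHÉS 47 (1977), Thm 8). For an elliptic curve `E/ℚ`, the torsion subgroup
`E(ℚ)_tors` is isomorphic to one of the fifteen groups `ℤ/nℤ` (`1 ≤ n ≤ 10` or `n = 12`) or
`ℤ/2ℤ × ℤ/2mℤ` (`1 ≤ m ≤ 4`). The elliptic hypothesis is quantified inside the fact (a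
`def … : Prop` does not pick up unused instance variables). [cite: Mazur1977, Thm 8] -/
def mazur_torsion : Prop :=
  ∀ [W.IsElliptic],
    (∃ n : ℕ, 1 ≤ n ∧ (n ≤ 10 ∨ n = 12) ∧
        Nonempty (AddCommGroup.torsion W.toAffine.Point ≃+ ZMod n)) ∨
      (∃ m : ℕ, 1 ≤ m ∧ m ≤ 4 ∧
        Nonempty (AddCommGroup.torsion W.toAffine.Point ≃+ ZMod 2 × ZMod (2 * m)))

end Mazur

/-! ### bsd.S06 — the L-series of an elliptic curve and its convergence -/

section LSeries

variable {K : Type*} [Field K] [NumberField K] (W : WeierstrassCurve K)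

/-- **bsd.S06** (definition of `L(E,s)`; Silverman AEC App. C §16). The L-series
`L(E,s) = ∑ₙ aₙ n⁻ˢ = ∏ₚ Lₚ(‖p‖⁻ˢ)⁻¹` of `W`, with local factors determined by the reduction type,
is Mathlib's `WeierstrassCurve.LSeries`; this lemma records that it is the Dirichlet series
`LSeries` of the coefficient sequence `n ↦ aₙ = W.LFunction n` (Mathlib's Euler product
`WeierstrassCurve.LFunction : ArithmeticFunction ℤ`). [folklore] -/
theorem lSeries_eq (s : ℂ) : W.LSeries s = _root_.LSeries ((↑) ∘ W.LFunction : ℕ → ℂ) s := rfl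

/-- **bsd.S06** (absolute convergence; Silverman AEC App. C §16, via the Hasse bound). For an
elliptic curve `W` over a number field the L-series `∑ aₙ n⁻ˢ` converges absolutely for
`Re s > 3/2`. [cite: SilvermanAEC2009, App. C §16] -/
def lSeriesSummable_lFunction_of_lt_re : Prop :=
  ∀ [W.IsElliptic] {s : ℂ}, 3 / 2 < s.re →
    LSeriesSummable ((↑) ∘ W.LFunction : ℕ → ℂ) s

/-- **bsd.S06** (abscissa form; Silverman AEC App. C §16). The abscissa of absolute convergence
of `L(E,s)` is at most `3/2`. [cite: SilvermanAEC2009, App. C §16] -/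
def abscissaOfAbsConv_lFunction_le : Prop :=
  ∀ [W.IsElliptic],
    LSeries.abscissaOfAbsConv ((↑) ∘ W.LFunction : ℕ → ℂ) ≤ (3 / 2 : ℝ)

end LSeries

/-! ### bsd.S07 — Hasse bound -/

section Hasse

variable {F : Type*} [Field F] (W : WeierstrassCurve F)

/-- **bsd.S07** (Hasse bound; Hasse 1933; Silverman AEC Thm V.1.1). For an elliptic curve `E`
over a finite field with `q` elements, `|q + 1 - #E(𝔽_q)| ≤ 2√q`, where `#E(𝔽_q)` counts the
rational points including the point at infinity. Finiteness of `F` and the elliptic hypothesis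
are quantified inside the fact (a `def … : Prop` does not pick up unused instance variables;
without them the statement would be false, `Nat.card F = 0` for infinite `F`).
[cite: SilvermanAEC2009, Thm. V.1.1] -/
def hasse_bound : Prop :=
  ∀ [Finite F] [W.IsElliptic],
    |(Nat.card F + 1 : ℝ) - Nat.card W.toAffine.Point| ≤ 2 * Real.sqrt (Nat.card F)

end Hasse

/-! ### bsd.S08 — analytic continuation (and functional equation) from modularity -/

section Modularity

variable (W : WeierstrassCurve ℚ)

/-- **bsd.S08** (analytic continuation of `L(E,s)`; Wiles, Ann. of Math. 141 (1995);
Taylor–Wiles 1995; Breuil–Conrad–Diamond–Taylor, JAMS 14 (2001) Thm A; Silverman AEC C.16).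
For an elliptic curve `E/ℚ`, the L-series `L(E,s)` (absolutely convergent for `Re s > 3/2`)
extends to an entire function: there is `g : ℂ → ℂ`, complex differentiable everywhere, agreeing
with `L(E,s)` on `Re s > 3/2`. (Such `g` is unique by the identity theorem.) The elliptic
hypothesis is quantified inside the fact (false for singular cubics, whose `L`-series is
`ζ`-like). [cite: BCDTJAMS2001, Thm. A] -/
def exists_differentiable_eqOn_lSeries : Prop :=
  ∀ [W.IsElliptic],
    ∃ g : ℂ → ℂ, Differentiable ℂ g ∧ ∀ s : ℂ, 3 / 2 < s.re → g s = W.LSeries s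

/-- **bsd.S08** (functional equation, continuation form with existential level and sign;
Breuil–Conrad–Diamond–Taylor, JAMS 14 (2001) Thm A with Hecke theory; Silverman AEC C.16).
For an elliptic curve `E/ℚ` there are a positive integer `N`, a sign `w ∈ {1, -1}` and an entire
function `Λ` such that `Λ(s) = N^{s/2} (2π)^{-s} Γ(s) L(E,s)` on the half-plane of absolute
convergence `Re s > 3/2` and `Λ(s) = w Λ(2 - s)` for all `s`. (The raw product cannot be used
for all `s` because Mathlib's `Complex.Gamma` is `0` on `ℤ_{≤0}`; on `Re s > 3/2` it has no junk
values, and `Λ` is unique by the identity theorem. In particular `s ↦ Λ(s) / (N^{s/2}(2π)^{-s}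
Γ(s))` recovers the entire continuation of `L(E,s)` off `ℤ_{≤0}`.) The sharper statement with
`N = N_E` the conductor and `w = w(E)` the global root number is
`Literature.NumberTheory.EllipticCurves.completedLFunction_functional_equation` in `Literature.Statements.BSD.RootNumber`.
[cite: BCDTJAMS2001, Thm. A] -/
def exists_completedLFunction_functional_equation : Prop :=
  ∀ [W.IsElliptic],
    ∃ N : ℕ, 0 < N ∧ ∃ w : ℤ, (w = 1 ∨ w = -1) ∧ ∃ Λ : ℂ → ℂ, Differentiable ℂ Λ ∧
        (∀ s : ℂ, 3 / 2 < s.re →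
          Λ s = (N : ℂ) ^ (s / 2) * (2 * Real.pi : ℂ) ^ (-s) * Complex.Gamma s * W.LSeries s) ∧
        ∀ s : ℂ, Λ s = w * Λ (2 - s)

end Modularity

/-! ### bsd.S26 — Bhargava–Shankar (average-rank clause) -/

section BhargavaShankar

/-- `AverageRankLE c`: when elliptic curves `E/ℚ` are ordered by naive height, the average rank
is at most `c`, i.e. `limsup_{X → ∞} (∑_{H(E) < X} rank E(ℚ)) / #{H(E) < X} ≤ c`, phrased via
the prelude's `Literature.NumberTheory.EllipticCurves.HeightAverageLE` (no `Filter.limsup`)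
(Bhargava–Shankar, Ann. of Math. 181 (2015) Thm 1.2). [folklore] -/
def AverageRankLE (c : ℝ) : Prop :=
  HeightAverageLE (fun AB ↦ ((shortWeierstrass AB).mordellWeilRank : ℝ)) c

/-- **bsd.S26** (Bhargava–Shankar, *Binary quartic forms having bounded invariants, and the
boundedness of the average rank of elliptic curves*, Ann. of Math. 181 (2015) 191–242, Thm 1.2).
When elliptic curves over `ℚ` are ordered by naive height, the average rank is at most `3/2`
(consequence of: the average size of the `2`-Selmer group is `3`, Thm 1.1 — that clause is
`Literature.NumberTheory.EllipticCurves.average_card_selmerTwo` in `Literature.Statements.BSD.Selmer`).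
[cite: BhargavaShankarAnnals2015, Thm 1.2] -/
def averageRankLE_three_halves : Prop :=
  AverageRankLE (3 / 2)

/-- **bsd.S26** (Bhargava–Shankar, *The average size of the 5-Selmer group of elliptic curves is
6, and the average rank is less than 1*, arXiv:1312.7859, Thm 3). When elliptic curves over `ℚ`
are ordered by naive height, the average rank is at most `0.885`.
[cite: BhargavaShankar5Selmer2013, Thm 3] -/
def averageRankLE_of_five_selmer : Prop :=
  AverageRankLE 0.885

/-- **bsd.S26** (Bhargava–Shankar, *Ternary cubic forms having bounded invariants, and the
existence of a positive proportion of elliptic curves having rank 0*, Ann. of Math. 181 (2015)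
587–621, §1, main corollary of the average `3`-Selmer bound combined with Dokchitser–Dokchitser
and Skinner–Urban). A positive proportion of elliptic curves over `ℚ`, ordered by naive height,
have Mordell–Weil rank `0`: `liminf_{X} #{H(E) < X, rank E(ℚ) = 0} / #{H(E) < X} > 0`, phrased
via the prelude's `Literature.NumberTheory.EllipticCurves.HeightDensityGE`. [cite: BhargavaShankarTernary2015, §1] -/
def pos_proportion_rank_zero : Prop :=
  ∃ δ : ℝ, 0 < δ ∧ HeightDensityGE (fun AB ↦ (shortWeierstrass AB).mordellWeilRank = 0) δ

end BhargavaShankar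

/-! ### bsd.S29 — Tunnell's theorem -/

section Tunnell

/-- A positive integer `n` is a *congruent number* if it is the area of a right triangle with
rational sides (Koblitz, *Introduction to Elliptic Curves and Modular Forms*, Ch. I §1).
[folklore] -/
def IsCongruentNumber (n : ℕ) : Prop :=
  ∃ a b c : ℚ, 0 < a ∧ 0 < b ∧ a ^ 2 + b ^ 2 = c ^ 2 ∧ a * b / 2 = n

/-- The number of integer representations `#{(x, y, z) ∈ ℤ³ | a x² + b y² + c z² = n}` of `n` by
the diagonal ternary form `⟨a, b, c⟩` (finite for positive-definite forms; `Set.ncard` returns the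
junk value `0` on infinite sets) (Tunnell, Invent. Math. 72 (1983)). [folklore] -/
def ternaryFormRepCount (a b c : ℤ) (n : ℤ) : ℕ :=
  {v : ℤ × ℤ × ℤ | a * v.1 ^ 2 + b * v.2.1 ^ 2 + c * v.2.2 ^ 2 = n}.ncard

/-- **bsd.S29** (Tunnell's theorem, odd case; Tunnell, *A classical Diophantine problem and
modular forms of weight 3/2*, Invent. Math. 72 (1983) 323–334, Theorem; Koblitz, *Introduction
to Elliptic Curves and Modular Forms*, Ch. IV). If `n` is an odd squarefree congruent number then
`#{x² + 2y² + 8z² = n} = 2 · #{x² + 2y² + 32z² = n}` (counting over `ℤ³`). The converse holds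
assuming BSD(RANK) for `E_n : y² = x³ - n²x`; that clause is
`Literature.BSD.tunnell_converse_odd` in `Literature.Statements.BSD.AnalyticRank`.
[cite: Tunnell1983Congruent, Theorem] -/
def tunnell_odd : Prop :=
  ∀ {n : ℕ}, Squarefree n → Odd n → IsCongruentNumber n →
    ternaryFormRepCount 1 2 8 n = 2 * ternaryFormRepCount 1 2 32 n

/-- **bsd.S29** (Tunnell's theorem, even case; Tunnell, Invent. Math. 72 (1983), Theorem;
Koblitz, *Introduction to Elliptic Curves and Modular Forms*, Ch. IV). If `n` is an even
squarefree congruent number then `#{8x² + 2y² + 16z² = n} = 2 · #{8x² + 2y² + 64z² = n}`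
(equivalently `#{4x² + y² + 8z² = n/2} = 2 · #{4x² + y² + 32z² = n/2}`).
[cite: Tunnell1983Congruent, Theorem] -/
def tunnell_even : Prop :=
  ∀ {n : ℕ}, Squarefree n → Even n → IsCongruentNumber n →
    ternaryFormRepCount 8 2 16 n = 2 * ternaryFormRepCount 8 2 64 n

end Tunnell

end Literature.NumberTheory.EllipticCurves

end
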